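import Summits.ResolutionOfSingularities.ResolutionOfSingularities.Theorems.EquisingularLiftEquisingularLiftNatResidueHypDefsE9
import HarnessLib

/-!
# [OURS · L1 W4.5(b) · EL♮ / EL♮(3)] RESIDUE HYPOTHESIS DEFS E9′ — WIDTH TABLE D17 «STAGE-0 TOWER BOOKKEEPING», THE RE-TYPED POINT STEP AND ITS CHAIN OF RECORD:
# `TowerPtRegB₅Prime`, door `ReachTowerNose₀Prime`, blob `NoseHypHostedNestEquinodalDirectCILiftTowerZeroPrimeSigmaPGBTriplePrime₂` (deprecate-and-add over ✓ …DefsE9)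

Typed by res-type-027 g24 on the desk's RULING R83 (2026-08-29T12:49:55Z) after res-L1-w45b-stub-4 g16's BY-TYPE FLAG (12:49Z): the through-arms of
✓ `TowerPtRegB₅` (…DefsE9 df36a909478a24ea :39–:56) keep a member `F ∋ y` MODEL-CARRYING with NO hypothesis on `F̃` at `y`, while the engine's only
construction (an `O`-section of the member's model through `y`, then the strict transform; ✓ HT1 p659650) needs `F̃` regular at `y` — witness inside the
letter's range `V(xy − t) ⊂ 𝔸³_O` — and several independent models through one point admit no joint section in general.  R83 asked for a re-type IN PLACE;
the gate's decl-level append-only rule for `Summits/…/Theorems` refuses body edits («deprecate, don't mutate») and the 400-line rule refuses the append, so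
the corrected chain lands HERE under primed names and the homonymous unprimed decls of …DefsE9 are DEPRECATED (cited by nothing; ✓ `TowerRoundB₅` is shared).
WHAT.  (T1′) `TowerPtRegB₅Prime F₁₀ R` («≤ 2» form, idea-3 g17's answer «2 members through p₂ and p₃ in ORDER B», crit-3 (F-ii)) = ✓ `TowerPtRegB₄` + binders
`(F₀ F₀' : Set G)` (the DESIGNATED through-members) + three hypotheses in blob-E8 / PAIR-round currency (each designated member that is a member through the
point has REGULAR reduced structure there — stub-4's/crit-2's 62-token arrow ×2; if both are distinct members through the point they cross transversally along a
reduced curve through the point whose reduced structure is regular and one-dimensional — `ConeWitness` + ✓ `TowerRoundBTriplePrime` branch-3 spellings, lead-2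
g10's input) + `curvePt G T y ∉ F ↦ (curvePt G T y ∉ F ∨ F = F₀ ∨ F = F₀')` in the E-menu's switch arm and the `Es'`-menu's transport arm; K-keeping arm,
K'-menu, `Ns'`-menu, conclusion verbatim.  (T3′) door `ReachTowerNose₀Prime k n T₁ F₉ β T₉ E₉` = `ReachTowerNose₀`'s text over `TowerPtRegB₅Prime`
(`TowerPtRamB₄`, `TowerRoundB₅` unchanged).  (T4′) blob `…LiftTowerZeroPrimeSigmaPGBTriplePrime₂` = ✓ blob E8 + the fifth menu disjunct `ReachTowerNose₀Prime …`.
(T5′) pure logic: `towerPtRegB₄_of_towerPtRegB₅Prime` (designated members `∅`, `∅`: all three arrows vacuous), E8 ⇒ E9′ (`Or.inl`), ΣPG ⇒ E9′, the REPLACE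
lemma `not_…DirectCILiftSigmaPGBTriplePrime₂_of_not_liftTowerZeroPrimeSigmaPG₂` (the 52nd's) and the chain down to `NoseHypPointsFirstBTriplePrime`.
Engine (stub-4 g16 (n1) `exc₄_transport_through`, (n2)/(n2b) constrained / joint section, ✓ (n3) seed p719789, nose-w1 (n4) ✓ `…TowerRoundBFiveClosure`,
(n5) driver, rung `nose_tower_rung_three`) binds to THESE letters.  OURS; NAMED HYPOTHESES, not statements of any manuscript ([Hironaka2017] is a candidate,
nothing of it is asserted); AI-written, weaker than expert review; definitions + pure logic only, no instance, no notation, standard axioms; EL♮(3) NOT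
proved; resolution in positive characteristic NOT proved.  `--kind definition --supports stmt-ResolutionOfSingularities-20148 --as helper`.
-/

set_option linter.dupNamespace false
noncomputable section
open CategoryTheory CategoryTheory.Limits AlgebraicGeometry TopologicalSpace Topology IsLocalRing
open Literature.AlgebraicGeometry.Resolution
open AlgebraicGeometry.Scheme.IdealSheafData
namespace Summit.ResolutionOfSingularities.ResolutionOfSingularities.Cruxes.EquisingularLiftNat.Sections


/-- **`TowerPtRegB₅Prime F₁₀ R`** — (T1′ = E9′, desk R83 on stub-4 g16's by-type flag; «≤ 2» form per idea-3 g17's answer «2»; SUPERSEDES ✓ …DefsE9's `TowerPtRegB₅`,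
whose unconditioned through-arms no `InvB₄`-motive can close — kept as a deprecated decl by the tree's append-only rule) the REGULAR POINT STEP of the
stage-0 tower (WIDTH TABLE D17): ✓ `TowerPtRegB₄` with TWO extra binders `(F₀ F₀' : Set G)` — the DESIGNATED members THROUGH the point — and THREE extra hypotheses in blob-E8
point-step currency: each designated member that is a member through the point has REGULAR reduced structure there, and if BOTH are distinct members
through the point they CROSS TRANSVERSALLY along a reduced curve `Z` through the point (`ConeWitness G F₀ _ F₀' Z _`: `Z = F₀ ∩ closure F₀'` with
`𝓘(F₀) + 𝓘(closure F₀') = 𝓘(Z)`) whose reduced structure `Z̃` is REGULAR and ONE-DIMENSIONAL (the PAIR round's currency verbatim, lead-2 g10's input: then the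
upstairs JOINT section on the two models — brick (n2b) — is a composition of ✓ `isRegular_subscheme_sup_of_trace_crossing` / `flat_…` / `exists_nested_section_closedImmersion`).
In the E-menu's switch arm and the `Es'`-menu's transport arm the B‴ condition `curvePt G T y ∉ F` becomes `curvePt G T y ∉ F ∨ F = F₀ ∨ F = F₀'`:
AT MOST TWO members through the point keep their models (as strict transforms), they are regular and transversal there; every other member through the
point survives model-less in `Ns'` (arm unchanged) or not at all.  Running-surface arm, K'-menu, `Ns'`-menu, conclusion = ✓ B‴ verbatim.
[OURS · named hypothesis fragment, no mathematical content of its own] -/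
def TowerPtRegB₅Prime (F₁₀ : Scheme.{0})
    (R : ∀ G : Scheme.{0}, (G ⟶ F₁₀) → Set G → Set G → List (Set G) → List (Set G) → Set G → Prop) : Prop :=
  ∀ (G G' : Scheme.{0}) (γ : G ⟶ F₁₀) (T E : Set G) (Es Ns : List (Set G)) (K F₀ F₀' : Set G) (y : redSub G (closure T) isClosed_closure)
      (υ₂ : G' ⟶ G) (hy : IsClosed ({curvePt G T y} : Set G)) (K' : Set G') (E' : Set G') (Es' Ns' : List (Set G')),
    R G γ T E Es Ns K →
    ¬ IsRegularLocalRing ((redSub G (closure T) isClosed_closure).presheaf.stalk y) →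
    IsRegularLocalRing (G.presheaf.stalk (curvePt G T y)) →
    IsBlowup υ₂ (Scheme.IdealSheafData.vanishingIdeal (⟨{curvePt G T y}, hy⟩ : Closeds G)) →
    -- E9′ (desk R83, «≤ 2» form): the designated through-members `F₀`, `F₀'` are REGULAR at the point (reduced structures) …
    (F₀ ∈ E :: Es → curvePt G T y ∈ F₀ → ∀ (hF₀ : IsClosed F₀) (e : ↥(redSub G F₀ hF₀)),
      (redSubι G F₀ hF₀ e : G) = curvePt G T y → IsRegularLocalRing ((redSub G F₀ hF₀).presheaf.stalk e)) →
    (F₀' ∈ E :: Es → curvePt G T y ∈ F₀' → ∀ (hF₀' : IsClosed F₀') (e : ↥(redSub G F₀' hF₀')),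
      (redSubι G F₀' hF₀' e : G) = curvePt G T y → IsRegularLocalRing ((redSub G F₀' hF₀').presheaf.stalk e)) →
    -- … and, if both are distinct members through the point, they CROSS TRANSVERSALLY along a reduced REGULAR CURVE `Z̃` through the point (PAIR-round
    -- currency verbatim: `ConeWitness` + `Z̃` regular + one-dimensional — lead-2 g10's by-type input, so that the joint-section brick is a composition of ✓ bricks)
    (F₀ ∈ E :: Es → F₀' ∈ E :: Es → F₀ ≠ F₀' → curvePt G T y ∈ F₀ → curvePt G T y ∈ F₀' → ∀ (hF₀ : IsClosed F₀),
      ∃ (Z : Set G) (hZ : IsClosed Z), ConeWitness G F₀ hF₀ F₀' Z hZ ∧ curvePt G T y ∈ Z ∧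
        (∀ x : redSub G Z hZ, IsRegularLocalRing ((redSub G Z hZ).presheaf.stalk x)) ∧
        (∀ z : ↥(redSub G Z hZ), IsClosed ({z} : Set ↥(redSub G Z hZ)) → ringKrullDim ((redSub G Z hZ).presheaf.stalk z) = ((1 : ℕ) : WithBot ℕ∞))) →
    (K' = ∅ ∨ (curvePt G T y ∉ closure K ∧ K' = closure (υ₂ ⁻¹' (K \ {curvePt G T y})))) →
    (E' = υ₂ ⁻¹' {curvePt G T y} ∨ (curvePt G T y ∉ E ∧ E' = closure (υ₂ ⁻¹' (E \ {curvePt G T y}))) ∨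
      (∃ F ∈ E :: Es, (curvePt G T y ∉ F ∨ F = F₀ ∨ F = F₀') ∧ E' = closure (υ₂ ⁻¹' (F \ {curvePt G T y})) ∧ K' = ∅)) →
    (∀ F' ∈ Es', (∃ F ∈ E :: Es, (curvePt G T y ∉ F ∨ F = F₀ ∨ F = F₀') ∧ F' = closure (υ₂ ⁻¹' (F \ {curvePt G T y}))) ∨ F' = υ₂ ⁻¹' {curvePt G T y}) →
    (∀ F' ∈ Ns', (∃ F ∈ (E :: Es) ++ Ns, F' = closure (υ₂ ⁻¹' (F \ {curvePt G T y}))) ∨ F' = υ₂ ⁻¹' {curvePt G T y}) →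
    R G' (υ₂ ≫ γ) (closure (υ₂ ⁻¹' (T \ {curvePt G T y}))) E' Es' Ns' K'

/-- **`ReachTowerNose₀Prime k n T₁ F₉ β T₉ E₉`** — (T3′; SUPERSEDES `ReachTowerNose₀`: same text over `TowerPtRegB₅Prime`) door τ0′ «STAGE-0 TOWER» (WIDTH TABLE D17, customer #4 = H₁₀ ⊃ Z₁₅ «rational (6,10,15)-nose»): `E₉ = ∅` and a
B-tower motive `R G γ T E Es Ns K` SEEDED AT THE INITIAL STAGE ITSELF — `R ℙⁿ (𝟙 _) T₁ ∅ [] [] ∅`: no nose blow-up, no carrier, no slot, no curve clause, host `∅`,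
empty lists — closed under `TowerPtRegB₅Prime`, `TowerPtRamB₄`, `TowerRoundB₅`, reaching `R F₉ β T₉ E' Es' Ns' K'`.  `T₁` is instantiated `Set.range ι` by the blob;
no `H`/`ι`/`γ'` binders (the body reads only `T₁`; there is no prior blow-up). [OURS · named hypothesis fragment, no mathematical content of its own] -/
def ReachTowerNose₀Prime (k : Type) [Field k] (n : ℕ) (T₁ : Set (Literature.AlgebraicGeometry.Motives.projectiveSpace n k).left) (F₉ : Scheme.{0}) (β : F₉ ⟶ (Literature.AlgebraicGeometry.Motives.projectiveSpace n k).left) (T₉ E₉ : Set F₉) : Prop :=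
  E₉ = ∅ ∧
  ∃ (E' : Set F₉) (Es' Ns' : List (Set F₉)) (K' : Set F₉),
    ∀ R : (∀ G : Scheme.{0}, (G ⟶ (Literature.AlgebraicGeometry.Motives.projectiveSpace n k).left) → Set G → Set G → List (Set G) → List (Set G) → Set G → Prop),
      R (Literature.AlgebraicGeometry.Motives.projectiveSpace n k).left (𝟙 (Literature.AlgebraicGeometry.Motives.projectiveSpace n k).left) T₁ ∅ [] [] ∅ →
      TowerPtRegB₅Prime (Literature.AlgebraicGeometry.Motives.projectiveSpace n k).left R → TowerPtRamB₄ (Literature.AlgebraicGeometry.Motives.projectiveSpace n k).left R → TowerRoundB₅ (Literature.AlgebraicGeometry.Motives.projectiveSpace n k).left R →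
      R F₉ β T₉ E' Es' Ns' K'

/-- **`NoseHypHostedNestEquinodalDirectCILiftTowerZeroPrimeSigmaPGBTriplePrime₂ k n H ι`** (D17 blob E9′ OF RECORD, initial menu «(((ν4 ∨ ν3ᵈΣPG) ∨ ν3ᶜⁱΣPG) ∨ νLIFT) ∨ τ0′»; SUPERSEDES ✓ …DefsE9's blob E9) —
✓ blob E8 (…DefsE8) VERBATIM except that the initial-stage nose menu has ONE MORE disjunct `ReachTowerNose₀Prime k n (Set.range ι) F₉ β T₉ E₉`.  More doors asked of `Q`
⇒ implied by blob E8 (`…_of_liftSigmaPG₂` below, pure logic); REPLACE shape «¬(E8 blob) ↦ ¬(this blob)» = the 52nd (desk R81/R83).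
[OURS · L1 W4.5b · named hypothesis, no mathematical content of its own] -/
def NoseHypHostedNestEquinodalDirectCILiftTowerZeroPrimeSigmaPGBTriplePrime₂ (k : Type) [Field k] [IsAlgClosed k] (n : ℕ) (H : AlgebraicGeometry.Scheme.{0})
    (ι : H ⟶ (Literature.AlgebraicGeometry.Motives.projectiveSpace n k).left) : Prop :=
  letI := MvPolynomial.gradedAlgebra (σ := Fin (n + 1)) (R := k)
  ∃ (E₀ : Set (Literature.AlgebraicGeometry.Motives.projectiveSpace n k).left),
    (E₀ = ∅ ∨ ∃ ℓ : MvPolynomial (Fin (n + 1)) k, ℓ.IsHomogeneous 1 ∧ ℓ ≠ 0 ∧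
      ¬ (Set.range ι ⊆ {y : (Literature.AlgebraicGeometry.Motives.projectiveSpace n k).left |
        ℓ ∈ (y : ProjectiveSpectrum (MvPolynomial.homogeneousSubmodule (Fin (n + 1)) k)).asHomogeneousIdeal}) ∧
      E₀ = {y : (Literature.AlgebraicGeometry.Motives.projectiveSpace n k).left |
        ℓ ∈ (y : ProjectiveSpectrum (MvPolynomial.homogeneousSubmodule (Fin (n + 1)) k)).asHomogeneousIdeal}) ∧
    (∃ (F' : AlgebraicGeometry.Scheme.{0}) (ρ' : F' ⟶ (Literature.AlgebraicGeometry.Motives.projectiveSpace n k).left) (T' : Set F'),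
      (∀ Q : (∀ F₁ : AlgebraicGeometry.Scheme.{0}, (F₁ ⟶ (Literature.AlgebraicGeometry.Motives.projectiveSpace n k).left) → Set F₁ → Set F₁ → Prop),
        Q (Literature.AlgebraicGeometry.Motives.projectiveSpace n k).left (𝟙 (Literature.AlgebraicGeometry.Motives.projectiveSpace n k).left) (Set.range ι) E₀ →
        (∀ (F₁ F₂ : AlgebraicGeometry.Scheme.{0}) (ρ : F₁ ⟶ (Literature.AlgebraicGeometry.Motives.projectiveSpace n k).left) (T₁ E₁ : Set F₁)
            (x : ↥((AlgebraicGeometry.Scheme.IdealSheafData.vanishingIdeal (⟨closure T₁, isClosed_closure⟩ : TopologicalSpace.Closeds F₁))).subscheme) (υ : F₂ ⟶ F₁) (hx : IsClosed ({(((AlgebraicGeometry.Scheme.IdealSheafData.vanishingIdeal (⟨closure T₁, isClosed_closure⟩ : TopologicalSpace.Closeds F₁))).subschemeι x : F₁)} : Set F₁)),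
          Q F₁ ρ T₁ E₁ → ¬ IsRegularLocalRing (((AlgebraicGeometry.Scheme.IdealSheafData.vanishingIdeal (⟨closure T₁, isClosed_closure⟩ : TopologicalSpace.Closeds F₁))).subscheme.presheaf.stalk x) →
          IsRegularLocalRing (F₁.presheaf.stalk (((AlgebraicGeometry.Scheme.IdealSheafData.vanishingIdeal (⟨closure T₁, isClosed_closure⟩ : TopologicalSpace.Closeds F₁))).subschemeι x : F₁)) →
          ((((AlgebraicGeometry.Scheme.IdealSheafData.vanishingIdeal (⟨closure T₁, isClosed_closure⟩ : TopologicalSpace.Closeds F₁))).subschemeι x : F₁) ∈ closure E₁ → ∀ e : ↥(redSub F₁ (closure E₁) isClosed_closure), (redSubι F₁ (closure E₁) isClosed_closure e : F₁) = (((AlgebraicGeometry.Scheme.IdealSheafData.vanishingIdeal (⟨closure T₁, isClosed_closure⟩ : TopologicalSpace.Closeds F₁))).subschemeι x : F₁) →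
          IsRegularLocalRing ((redSub F₁ (closure E₁) isClosed_closure).presheaf.stalk e)) → Literature.AlgebraicGeometry.Resolution.IsBlowup υ
            (AlgebraicGeometry.Scheme.IdealSheafData.vanishingIdeal (⟨{(((AlgebraicGeometry.Scheme.IdealSheafData.vanishingIdeal (⟨closure T₁, isClosed_closure⟩ : TopologicalSpace.Closeds F₁))).subschemeι x : F₁)}, hx⟩ : TopologicalSpace.Closeds F₁)) →
          Q F₂ (υ ≫ ρ) (closure (υ ⁻¹' (T₁ \ {(((AlgebraicGeometry.Scheme.IdealSheafData.vanishingIdeal (⟨closure T₁, isClosed_closure⟩ : TopologicalSpace.Closeds F₁))).subschemeι x : F₁)}))) (closure (υ ⁻¹' (E₁ \ {(((AlgebraicGeometry.Scheme.IdealSheafData.vanishingIdeal (⟨closure T₁, isClosed_closure⟩ : TopologicalSpace.Closeds F₁))).subschemeι x : F₁)})))) →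
        -- STAGE-LEVEL HOSTED ROUND at a regular curve `Z` inside the host, unobstructed IN THE HOST (in-host NEST lines and the nose curve alike)
        (∀ (F₁ F₃ : AlgebraicGeometry.Scheme.{0}) (ρ : F₁ ⟶ (Literature.AlgebraicGeometry.Motives.projectiveSpace n k).left) (T₁ E₁ : Set F₁) (Z : Set F₁) (hZ : IsClosed Z) (υ' : F₃ ⟶ F₁),
          Q F₁ ρ T₁ E₁ → Z ⊆ closure E₁ → Z ⊆ T₁ → ¬ T₁ ⊆ Z → (∀ z : ↥(redSub F₁ Z hZ), IsRegularLocalRing ((redSub F₁ Z hZ).presheaf.stalk z)) →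
          (∀ (i : redSub F₁ Z hZ ⟶ redSub F₁ (closure E₁) isClosed_closure), i ≫ redSubι F₁ (closure E₁) isClosed_closure = redSubι F₁ Z hZ →
            ∀ z : ↥(redSub F₁ Z hZ), IsRegularLocalRing ((redSub F₁ (closure E₁) isClosed_closure).presheaf.stalk (i z))) → DirStepUnobs F₁ (closure E₁) isClosed_closure Z hZ →
          (∀ z : ↥(redSub F₁ Z hZ), IsClosed ({z} : Set ↥(redSub F₁ Z hZ)) → ringKrullDim ((redSub F₁ Z hZ).presheaf.stalk z) = ((1 : ℕ) : WithBot ℕ∞)) →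
          Literature.AlgebraicGeometry.Resolution.IsBlowup υ' (AlgebraicGeometry.Scheme.IdealSheafData.vanishingIdeal (⟨Z, hZ⟩ : TopologicalSpace.Closeds F₁)) →
          Q F₃ (υ' ≫ ρ) (closure (υ' ⁻¹' (T₁ \ Z))) (closure (υ' ⁻¹' (closure E₁ \ Z)))) →
        (∀ (F₁ : AlgebraicGeometry.Scheme.{0}) (ρ : F₁ ⟶ (Literature.AlgebraicGeometry.Motives.projectiveSpace n k).left) (T₁ E₁ : Set F₁) (F₉ : AlgebraicGeometry.Scheme.{0}) (β : F₉ ⟶ F₁) (T₉ E₉ : Set F₉),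
          Q F₁ ρ T₁ E₁ → ReachHostedNoseBTriplePrime F₁ T₁ E₁ F₉ β T₉ E₉ → Q F₉ (β ≫ ρ) T₉ E₉) →
        -- INITIAL-STAGE NOSE, host named as the hyperplane `E₀ = V₊(ℓ)`: door ν4 «EQUINODAL» OR door ν3ᵈΣPG «DIRECT PLANAR» (both inside the host) OR door ν3ᶜⁱΣPG
        -- «ci-DIRECT» (host-free, `ℓ` a dummy) OR — NEW, D15 — door νLIFT «ν-LIFT NOSE» (`ReachLiftNoseSigmaPG₂`: host-free, door-owned point steps at `S`, the
        -- round at the strict transform of `Z` with an upstairs centre handed by the slot `NoseLift₀`, then a B‴ tail)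
        -- OR — NEW, D17 — door τ0 «STAGE-0 TOWER» (`ReachTowerNose₀Prime`: host-free, no nose blow-up, no carrier, no slot: a B-tower seeded at the stage itself,
        -- closed under point steps that may keep a member THROUGH the point model-carrying, fat point steps, and carrier-free hosted / pair / K-fibre rounds)
        (∀ (ℓ : MvPolynomial (Fin (n + 1)) k) (F₉ : AlgebraicGeometry.Scheme.{0}) (β : F₉ ⟶ (Literature.AlgebraicGeometry.Motives.projectiveSpace n k).left) (T₉ E₉ : Set F₉),
          Q (Literature.AlgebraicGeometry.Motives.projectiveSpace n k).left (𝟙 (Literature.AlgebraicGeometry.Motives.projectiveSpace n k).left) (Set.range ι) E₀ →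
          E₀ = {y : (Literature.AlgebraicGeometry.Motives.projectiveSpace n k).left |
            ℓ ∈ (y : ProjectiveSpectrum (MvPolynomial.homogeneousSubmodule (Fin (n + 1)) k)).asHomogeneousIdeal} →
          ((((ReachEquinodalPlanarNose₂ k n ℓ (Set.range ι) F₉ β T₉ E₉ ∨ ReachDirectPlanarNoseSigmaPG₂ k n ℓ (Set.range ι) F₉ β T₉ E₉) ∨
              ReachDirectCINoseSigmaPG₂ k n (Set.range ι) F₉ β T₉ E₉) ∨
              ReachLiftNoseSigmaPG₂ k n H ι (Set.range ι) F₉ β T₉ E₉) ∨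
              ReachTowerNose₀Prime k n (Set.range ι) F₉ β T₉ E₉) →
            Q F₉ β T₉ E₉) → ∃ E' : Set F', Q F' ρ' T' E') ∧
      Literature.AlgebraicGeometry.Resolution.Scheme.IsRegular (AlgebraicGeometry.Scheme.IdealSheafData.vanishingIdeal (⟨closure T', isClosed_closure⟩ : TopologicalSpace.Closeds F')).subscheme)


/-- (T5a′) a motive closed under `TowerPtRegB₅Prime` is closed under ✓ `TowerPtRegB₄`: every B‴ step is an E9′ step with designated members `F₀ := ∅`,
`F₀' := ∅` (all three E9′ hypotheses vacuous since `curvePt G T y ∉ ∅`) and the `∉` disjunct in both arms.  For the engine's reuse of ✓ `Tower.invB₄_ptRegStep`. [OURS · pure logic] -/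
theorem towerPtRegB₄_of_towerPtRegB₅Prime (F₁₀ : Scheme.{0})
    (R : ∀ G : Scheme.{0}, (G ⟶ F₁₀) → Set G → Set G → List (Set G) → List (Set G) → Set G → Prop)
    (h : TowerPtRegB₅Prime F₁₀ R) : TowerPtRegB₄ F₁₀ R := by
  intro G G' γ T E Es Ns K y υ₂ hy K' E' Es' Ns' hR hnreg hreg hυ hK hE hEs hNs
  -- designated through-members `F₀ := ∅`, `F₀' := ∅`: the three E9′ hypotheses are vacuous (`curvePt G T y ∉ ∅`), and every B‴ arm is the `∉` disjunct
  refine h G G' γ T E Es Ns K ∅ ∅ y υ₂ hy K' E' Es' Ns' hR hnreg hreg hυ (fun _ h0 => absurd h0 (Set.notMem_empty _))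
    (fun _ h0 => absurd h0 (Set.notMem_empty _)) (fun _ _ hne => absurd rfl hne) hK ?_ ?_ hNs
  · rcases hE with hE | hE | ⟨F, hF, hnot, hE, hK'⟩
    · exact Or.inl hE
    · exact Or.inr (Or.inl hE)
    · exact Or.inr (Or.inr ⟨F, hF, Or.inl hnot, hE, hK'⟩)
  · intro F' hF'
    rcases hEs F' hF' with ⟨F, hF, hnot, hF'⟩ | hF'
    · exact Or.inl ⟨F, hF, Or.inl hnot, hF'⟩
    · exact Or.inr hF'

/-- blob E8 (✓ DefsE8, the 51st's residue blob) ⇒ blob E9: a motive closed under the WIDER initial menu is closed under E8's. [OURS · pure logic] -/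
theorem noseHypHostedNestEquinodalDirectCILiftTowerZeroPrimeSigmaPGBTriplePrime₂_of_liftSigmaPG₂ (k : Type) [Field k] [IsAlgClosed k] (n : ℕ)
    (H : AlgebraicGeometry.Scheme.{0}) (ι : H ⟶ (Literature.AlgebraicGeometry.Motives.projectiveSpace n k).left)
    (h : NoseHypHostedNestEquinodalDirectCILiftSigmaPGBTriplePrime₂ k n H ι) :
    NoseHypHostedNestEquinodalDirectCILiftTowerZeroPrimeSigmaPGBTriplePrime₂ k n H ι := by
  obtain ⟨E₀, hE₀, F', ρ', T', hQ, hreg⟩ := h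
  refine ⟨E₀, hE₀, F', ρ', T', fun Q hQ0 hpt hround hreach hmenu => hQ Q hQ0 hpt hround hreach ?_, hreg⟩
  intro ℓ F₉ β T₉ E₉ hQ₀ hE hR
  exact hmenu ℓ F₉ β T₉ E₉ hQ₀ hE (Or.inl hR)

/-- the ΣPG blob (✓ DefsE7) ⇒ blob E9. [OURS · pure logic] -/
theorem noseHypHostedNestEquinodalDirectCILiftTowerZeroPrimeSigmaPGBTriplePrime₂_of_directCISigmaPG₂ (k : Type) [Field k] [IsAlgClosed k] (n : ℕ)
    (H : AlgebraicGeometry.Scheme.{0}) (ι : H ⟶ (Literature.AlgebraicGeometry.Motives.projectiveSpace n k).left)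
    (h : NoseHypHostedNestEquinodalDirectCISigmaPGBTriplePrime₂ k n H ι) :
    NoseHypHostedNestEquinodalDirectCILiftTowerZeroPrimeSigmaPGBTriplePrime₂ k n H ι :=
  noseHypHostedNestEquinodalDirectCILiftTowerZeroPrimeSigmaPGBTriplePrime₂_of_liftSigmaPG₂ k n H ι
    (noseHypHostedNestEquinodalDirectCILiftSigmaPGBTriplePrime₂_of_directCISigmaPG₂ k n H ι h)

/-- Contrapositive, as a D17 REPLACE cut «¬(E8 blob) ↦ ¬(E9 blob)» consumes it: the new residue hypothesis implies the old one. [OURS · pure logic] -/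
theorem not_noseHypHostedNestEquinodalDirectCILiftSigmaPGBTriplePrime₂_of_not_liftTowerZeroPrimeSigmaPG₂ (k : Type) [Field k] [IsAlgClosed k] (n : ℕ)
    (H : AlgebraicGeometry.Scheme.{0}) (ι : H ⟶ (Literature.AlgebraicGeometry.Motives.projectiveSpace n k).left)
    (h : ¬ NoseHypHostedNestEquinodalDirectCILiftTowerZeroPrimeSigmaPGBTriplePrime₂ k n H ι) :
    ¬ NoseHypHostedNestEquinodalDirectCILiftSigmaPGBTriplePrime₂ k n H ι :=
  fun h' => h (noseHypHostedNestEquinodalDirectCILiftTowerZeroPrimeSigmaPGBTriplePrime₂_of_liftSigmaPG₂ k n H ι h')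

/-- … `¬ (E9 blob) → ¬ (ΣPG blob)` (50th-level). [OURS · pure logic] -/
theorem not_noseHypHostedNestEquinodalDirectCISigmaPGBTriplePrime₂_of_not_liftTowerZeroPrimeSigmaPG₂ (k : Type) [Field k] [IsAlgClosed k] (n : ℕ)
    (H : AlgebraicGeometry.Scheme.{0}) (ι : H ⟶ (Literature.AlgebraicGeometry.Motives.projectiveSpace n k).left)
    (h : ¬ NoseHypHostedNestEquinodalDirectCILiftTowerZeroPrimeSigmaPGBTriplePrime₂ k n H ι) :
    ¬ NoseHypHostedNestEquinodalDirectCISigmaPGBTriplePrime₂ k n H ι :=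
  not_noseHypHostedNestEquinodalDirectCISigmaPGBTriplePrime₂_of_not_liftSigmaPG₂ k n H ι
    (not_noseHypHostedNestEquinodalDirectCILiftSigmaPGBTriplePrime₂_of_not_liftTowerZeroPrimeSigmaPG₂ k n H ι h)

/-- … `¬ (E9 blob) → ¬ (Σ blob)` (49th-level). [OURS · pure logic] -/
theorem not_noseHypHostedNestEquinodalDirectCISigmaBTriplePrime₂_of_not_liftTowerZeroPrimeSigmaPG₂ (k : Type) [Field k] [IsAlgClosed k] (n : ℕ)
    (H : AlgebraicGeometry.Scheme.{0}) (ι : H ⟶ (Literature.AlgebraicGeometry.Motives.projectiveSpace n k).left)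
    (h : ¬ NoseHypHostedNestEquinodalDirectCILiftTowerZeroPrimeSigmaPGBTriplePrime₂ k n H ι) :
    ¬ NoseHypHostedNestEquinodalDirectCISigmaBTriplePrime₂ k n H ι :=
  not_noseHypHostedNestEquinodalDirectCISigmaBTriplePrime₂_of_not_liftSigmaPG₂ k n H ι
    (not_noseHypHostedNestEquinodalDirectCILiftSigmaPGBTriplePrime₂_of_not_liftTowerZeroPrimeSigmaPG₂ k n H ι h)

/-- … `¬ (E9 blob) → ¬ (47th blob)`. [OURS · pure logic] -/
theorem not_noseHypHostedNestEquinodalDirectCIBTriplePrime₂_of_not_liftTowerZeroPrimeSigmaPG₂ (k : Type) [Field k] [IsAlgClosed k] (n : ℕ)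
    (H : AlgebraicGeometry.Scheme.{0}) (ι : H ⟶ (Literature.AlgebraicGeometry.Motives.projectiveSpace n k).left)
    (h : ¬ NoseHypHostedNestEquinodalDirectCILiftTowerZeroPrimeSigmaPGBTriplePrime₂ k n H ι) :
    ¬ NoseHypHostedNestEquinodalDirectCIBTriplePrime₂ k n H ι :=
  not_noseHypHostedNestEquinodalDirectCIBTriplePrime₂_of_not_liftSigmaPG₂ k n H ι
    (not_noseHypHostedNestEquinodalDirectCILiftSigmaPGBTriplePrime₂_of_not_liftTowerZeroPrimeSigmaPG₂ k n H ι h)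

/-- … `¬ (E9 blob) → ¬ (46th blob)`. [OURS · pure logic] -/
theorem not_noseHypHostedNestEquinodalDirectBTriplePrime₂_of_not_liftTowerZeroPrimeSigmaPG₂ (k : Type) [Field k] [IsAlgClosed k] (n : ℕ)
    (H : AlgebraicGeometry.Scheme.{0}) (ι : H ⟶ (Literature.AlgebraicGeometry.Motives.projectiveSpace n k).left)
    (h : ¬ NoseHypHostedNestEquinodalDirectCILiftTowerZeroPrimeSigmaPGBTriplePrime₂ k n H ι) :
    ¬ NoseHypHostedNestEquinodalDirectBTriplePrime₂ k n H ι :=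
  not_noseHypHostedNestEquinodalDirectBTriplePrime₂_of_not_liftSigmaPG₂ k n H ι
    (not_noseHypHostedNestEquinodalDirectCILiftSigmaPGBTriplePrime₂_of_not_liftTowerZeroPrimeSigmaPG₂ k n H ι h)

/-- … `¬ (E9 blob) → ¬ blob₃ᵉ v2`. [OURS · pure logic] -/
theorem not_noseHypHostedNestEquinodalBTriplePrime₂_of_not_liftTowerZeroPrimeSigmaPG₂ (k : Type) [Field k] [IsAlgClosed k] (n : ℕ)
    (H : AlgebraicGeometry.Scheme.{0}) (ι : H ⟶ (Literature.AlgebraicGeometry.Motives.projectiveSpace n k).left)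
    (h : ¬ NoseHypHostedNestEquinodalDirectCILiftTowerZeroPrimeSigmaPGBTriplePrime₂ k n H ι) :
    ¬ NoseHypHostedNestEquinodalBTriplePrime₂ k n H ι :=
  not_noseHypHostedNestEquinodalBTriplePrime₂_of_not_liftSigmaPG₂ k n H ι
    (not_noseHypHostedNestEquinodalDirectCILiftSigmaPGBTriplePrime₂_of_not_liftTowerZeroPrimeSigmaPG₂ k n H ι h)

/-- … `¬ (E9 blob) → ¬ blob₂`. [OURS · pure logic] -/
theorem not_noseHypHostedNestBTriplePrime₂_of_not_liftTowerZeroPrimeSigmaPG₂ (k : Type) [Field k] [IsAlgClosed k] (n : ℕ)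
    (H : AlgebraicGeometry.Scheme.{0}) (ι : H ⟶ (Literature.AlgebraicGeometry.Motives.projectiveSpace n k).left)
    (h : ¬ NoseHypHostedNestEquinodalDirectCILiftTowerZeroPrimeSigmaPGBTriplePrime₂ k n H ι) :
    ¬ NoseHypHostedNestBTriplePrime₂ k n H ι :=
  not_noseHypHostedNestBTriplePrime₂_of_not_liftSigmaPG₂ k n H ι
    (not_noseHypHostedNestEquinodalDirectCILiftSigmaPGBTriplePrime₂_of_not_liftTowerZeroPrimeSigmaPG₂ k n H ι h)

/-- … `¬ (E9 blob) → ¬ NoseHypPointsFirstBTriplePrime`. [OURS · pure logic] -/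
theorem not_noseHypPointsFirstBTriplePrime_of_not_liftTowerZeroPrimeSigmaPG₂ (k : Type) [Field k] [IsAlgClosed k] (n : ℕ)
    (H : AlgebraicGeometry.Scheme.{0}) (ι : H ⟶ (Literature.AlgebraicGeometry.Motives.projectiveSpace n k).left)
    (h : ¬ NoseHypHostedNestEquinodalDirectCILiftTowerZeroPrimeSigmaPGBTriplePrime₂ k n H ι) :
    ¬ NoseHypPointsFirstBTriplePrime k n H ι :=
  not_noseHypPointsFirstBTriplePrime_of_not_liftSigmaPG₂ k n H ι
    (not_noseHypHostedNestEquinodalDirectCILiftSigmaPGBTriplePrime₂_of_not_liftTowerZeroPrimeSigmaPG₂ k n H ι h)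

end Summit.ResolutionOfSingularities.ResolutionOfSingularities.Cruxes.EquisingularLiftNat.Sections

end
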